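import Literature.Analysis.FluidPDE.ChaeWolfDSSUniformEnergy
import Literature.Analysis.FluidPDE.ChaeWolfDSSDecayCubicAllQ
import Literature.Analysis.FluidPDE.ChaeWolfDSSPressureFarField
import Literature.Analysis.FluidPDE.ChaeWolfRemovingDSSDecomposition
import HarnessLib

/-!
# Chae–Wolf 2017, Theorem 1.1 — the range `p ≥ 9` and the discharge of
# `chaeWolf2017_dss_typeI_decay`

Analysis/FluidPDE proofs file (theorems only; no definitions, no named facts). It DISCHARGES the
named facts `Literature.Analysis.FluidPDE.chaeWolf2017_dss_typeI_decay_ge_nine`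
(`ChaeWolfRemovingDSSDecomposition.lean`) and, through the tree's assembly
`chaeWolf2017_dss_typeI_decay_holds_of`, the parent `Literature.Analysis.FluidPDE.chaeWolf2017_dss_typeI_decay`
(`ChaeWolfRemovingDSS.lean`; D. Chae, J. Wolf, *Removing discretely self-similar singularities for
the 3D Navier–Stokes equations*, Comm. PDE 42 (2017) 1359–1374 = arXiv:1610.09464, **Theorem 1.1**:
for `3 ≤ p < ∞`, a `λ`-DSS solution `u ∈ C((−∞,0); L^p(ℝ³)) ∩ C^∞` is regular on
`Q̄ ∖ {(0,0)}` and `|u(x,t)| ≤ C/(√(−t) + |x|)`).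

The tree proves the theorem for `3 ≤ p < 9` (`chaeWolf2017_dss_typeI_decay_of_lt_nine`). For
`p ≥ 9` the printed Step 4 (arXiv p. 6–7) invokes Wolf's pressure-free ε-regularity criterion
[Wolf2015c], which the tree does not have; here the same conclusion is reached with the tree's
Caffarelli–Kohn–Nirenberg / Gustafson–Kang–Tsai ε-regularity at the top point
(`exists_bound_near_top_of_classical_Iio`), whose two inputs are produced for every `p`:

* the **pressure class** `p − m ∈ L^{3/2}(Q_ρ(z₀))` from the near/far splitting of the slice
  pressures (`IsClassicalNSSolutionOn.exists_pressure_class_of_farField`,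
  `ChaeWolfDSSPressureFarField.lean`), whose far-field input is supplied here by the LINEAR growth
  of the local energy of a DSS field — `exists_farField_bound_of_dss`: if
  `∫_{B(0,R₀)} |u(t)|² ≤ M₀` for `t ∈ (−ρ², 0)` then, by self-similarity,
  `∫_{B(0, λᵏR₀)} |u(t)|² ≤ λᵏ M₀`, and summing over the shells `λᵏa ≤ |y| < λ^{k+1}a` gives
  `∫_{|y|≥a} |u(t, x₀+y)|²/|y|³ ≤ λ M₀ a⁻³ /(1 − λ⁻²)` (this is the tree-side replacement of the
  local pressure estimates of [Wolf2015c]);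
* **`C(r) → 0`** at the top points from the weighted Serrin estimate (2.7a) and the scale-invariant
  energy bound (2.17) (`tendsto_cknC_zero_of_weighted_lt_top_of_energy`,
  `ChaeWolfDSSDecayCubicAllQ.lean`; `exists_scaleInvariant_energy_bound`,
  `ChaeWolfDSSUniformEnergy.lean`).

Main results:

* `ChaeWolfDecay.exists_farField_bound_of_dss` — the far-field weight bound for DSS fields;
* `ChaeWolfDecay.lintegral_cube_lt_top_of_energy_bound` — `∫∫_{Q_r}|u|³ < ∞` from `A, E < ∞`;
* `chaeWolf2017_dss_typeI_decay_of_ge_nine` — **Theorem 1.1 for `p ≥ 9`**;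
* `chaeWolf2017_dss_typeI_decay_ge_nine_holds`, `chaeWolf2017_dss_typeI_decay_holds` — the
  discharges.

## References

* D. Chae, J. Wolf, arXiv:1610.09464, Thm. 1.1 and §2 (p. 3, 5–7). [ChaeWolf2017RemovingDSS]
* S. Gustafson, K. Kang, T.-P. Tsai, Comm. Math. Phys. 273 (2007), Thm. 1.1. [GustafsonKangTsai2007]
* D. Chae, R. Shvydkoy, Arch. Ration. Mech. Anal. 209 (2013), Lemma 3.3. [ChaeShvydkoy2013]
-/

noncomputable section

open MeasureTheory TopologicalSpace Set Function Filter Metric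
open _root_.Topology
open scoped ENNReal NNReal

namespace Literature.Analysis.FluidPDE

namespace ChaeWolfDecay

variable {u : ℝ → EuclideanSpace ℝ (Fin 3) → EuclideanSpace ℝ (Fin 3)}

/-! ### The far field of a DSS field: linear growth of the local energy -/

section FarField

/-- **Self-similarity transports the local energy: `∫_{B(0,γR)} |u(t)|² = γ ∫_{B(0,R)} |u(t/γ²)|²`**
for a `γ`-DSS field, `γ > 0` (change of variables `x = γy` and `u(t, γy) = γ⁻¹ u(t/γ², y)`). [cite: ChaeWolf2017RemovingDSS, (1.2) and §2 Step 1 (arXiv p. 2, 5)] -/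
theorem setLIntegral_ball_normSq_eq_of_dss {γ : ℝ} (hγ : 0 < γ) (h : IsDiscretelySelfSimilar γ u)
    (t R : ℝ) :
    ∫⁻ x in ball (0 : EuclideanSpace ℝ (Fin 3)) (γ * R), ‖u t x‖ₑ ^ 2 =
      ENNReal.ofReal γ * ∫⁻ y in ball (0 : EuclideanSpace ℝ (Fin 3)) R, ‖u (t / γ ^ 2) y‖ₑ ^ 2 := by
  have hγ2 : 0 < γ ^ 2 := by positivity
  -- the DSS relation `u(t, γ y) = γ⁻¹ u(t/γ², y)`
  have hrel : ∀ y, u t (γ • y) = γ⁻¹ • u (t / γ ^ 2) y := by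
    intro y
    have key := congrFun (congrFun h (t / γ ^ 2)) y
    rw [nsRescale_apply, mul_div_cancel₀ _ hγ2.ne'] at key
    rw [← key, smul_smul, inv_mul_cancel₀ hγ.ne', one_smul]
  -- change of variables `x = γ y`
  have hpre : (fun y : EuclideanSpace ℝ (Fin 3) => (0 : EuclideanSpace ℝ (Fin 3)) + γ • y) ⁻¹'
      ball (0 : EuclideanSpace ℝ (Fin 3)) (γ * R) = ball 0 R := by
    rw [space_affine_preimage_ball hγ, sub_zero, smul_zero, mul_div_cancel_left₀ _ hγ.ne']
  have hcv := setLIntegral_preimage_comp_space_affine hγ (0 : EuclideanSpace ℝ (Fin 3))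
    (fun x => ‖u t x‖ₑ ^ 2) (ball (0 : EuclideanSpace ℝ (Fin 3)) (γ * R))
  rw [hpre, finrank_euclideanSpace_fin] at hcv
  -- `∫_S F = γ³ ∫_{ball 0 R} F(γ y)`
  have hγ3 : ENNReal.ofReal (γ ^ 3) * ENNReal.ofReal (γ ^ 3)⁻¹ = 1 := by
    rw [← ENNReal.ofReal_mul (by positivity), mul_inv_cancel₀ (by positivity), ENNReal.ofReal_one]
  have e1 : ∫⁻ x in ball (0 : EuclideanSpace ℝ (Fin 3)) (γ * R), ‖u t x‖ₑ ^ 2 =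
      ENNReal.ofReal (γ ^ 3) * ∫⁻ y in ball (0 : EuclideanSpace ℝ (Fin 3)) R, ‖u t ((0 : EuclideanSpace ℝ (Fin 3)) + γ • y)‖ₑ ^ 2 := by
    rw [hcv, ← mul_assoc, hγ3, one_mul]
  rw [e1]
  have e2 : ∫⁻ y in ball (0 : EuclideanSpace ℝ (Fin 3)) R, ‖u t ((0 : EuclideanSpace ℝ (Fin 3)) + γ • y)‖ₑ ^ 2 =
      ENNReal.ofReal (γ⁻¹) ^ 2 * ∫⁻ y in ball (0 : EuclideanSpace ℝ (Fin 3)) R, ‖u (t / γ ^ 2) y‖ₑ ^ 2 := by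
    rw [← lintegral_const_mul' _ _ (ENNReal.pow_ne_top ENNReal.ofReal_ne_top)]
    refine lintegral_congr fun y => ?_
    rw [zero_add, hrel y, enorm_smul, mul_pow, Real.enorm_eq_ofReal (inv_nonneg.2 hγ.le)]
  rw [e2, ← mul_assoc, ← ENNReal.ofReal_pow (inv_nonneg.2 hγ.le), ← ENNReal.ofReal_mul (by positivity)]
  congr 1
  field_simp

/-- **The far-field weight of a DSS field is bounded, uniformly in time, by the local energy.**
Let `u` be `c`-DSS, `1 < c`, with `∫_{B(0,R₀)} |u(t)|² ≤ M₀` for `t ∈ (−ρ², 0)`, and let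
`x₀ ∈ ℝ³`, `a > 0` with `‖x₀‖ + a ≤ R₀`; assume the slices `u(t)`, `t < 0`, are in `L^q`, `q > 2`
(so that the weight is integrable). Then for `t ∈ (−ρ², 0)`:
`∫_{|y| ≥ a} |u(t, x₀ + y)|²/|y|³ ≤ W₀ := c M₀ a⁻³ (1 − c⁻²)⁻¹`. Proof: on the shell
`cᵏa ≤ |y| < c^{k+1}a` the weight is `≤ (cᵏa)⁻³` and `B(x₀, c^{k+1}a) ⊆ B(0, c^{k+1}R₀)`, where
self-similarity gives `∫_{B(0,c^{k+1}R₀)}|u(t)|² = c^{k+1}∫_{B(0,R₀)}|u(t c^{−2(k+1)})|² ≤ c^{k+1}M₀`;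
sum the geometric series. [cite: ChaeWolf2017RemovingDSS, (1.2), §2 Step 2 (2.4c) and Step 3 (arXiv p. 5–6)] -/
theorem exists_farField_bound_of_dss {c : ℝ} (hc : 1 < c) (hdss : IsDiscretelySelfSimilar c u)
    {q : ℝ} (hq : 2 < q) (hLq : ∀ t < 0, MemLp (u t) (ENNReal.ofReal q) volume)
    {ρ R₀ : ℝ} {M₀ : ℝ≥0}
    (hM₀ : ∀ t ∈ Ioo (-ρ ^ 2) 0, ∫⁻ x in ball (0 : EuclideanSpace ℝ (Fin 3)) R₀, ‖u t x‖ₑ ^ 2 ≤ M₀)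
    (x₀ : EuclideanSpace ℝ (Fin 3)) {a : ℝ} (ha : 0 < a) (hR₀ : ‖x₀‖ + a ≤ R₀) :
    ∃ W₀ : ℝ, ∀ t ∈ Ioo (-ρ ^ 2) 0,
      ∫ y in (ball (0 : EuclideanSpace ℝ (Fin 3)) a)ᶜ, ‖u t (x₀ + y)‖ ^ 2 / ‖y‖ ^ 3 ≤ W₀ := by
  have hc0 : 0 < c := one_pos.trans hc
  -- the geometric ratio
  set r : ℝ≥0∞ := ENNReal.ofReal ((c ^ 2)⁻¹) with hr
  have hr1 : r < 1 := by
    rw [hr, ← ENNReal.ofReal_one]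
    exact (ENNReal.ofReal_lt_ofReal_iff one_pos).2 (inv_lt_one_of_one_lt₀ (by nlinarith))
  set Wₑ : ℝ≥0∞ := ENNReal.ofReal (c / a ^ 3) * M₀ * (1 - r)⁻¹ with hWₑ
  have hWₑt : Wₑ ≠ ⊤ := by
    refine ENNReal.mul_ne_top (ENNReal.mul_ne_top ENNReal.ofReal_ne_top ENNReal.coe_ne_top) ?_
    exact ENNReal.inv_ne_top.2 (tsub_pos_of_lt hr1).ne'
  refine ⟨Wₑ.toReal, fun t ht => ?_⟩
  have ht0 : t < 0 := ht.2
  -- translation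
  have hmp : MeasurePreserving (fun x : EuclideanSpace ℝ (Fin 3) => x₀ + x) volume volume :=
    measurePreserving_add_left volume x₀
  have hme : MeasurableEmbedding (fun x : EuclideanSpace ℝ (Fin 3) => x₀ + x) :=
    (Homeomorph.addLeft x₀).measurableEmbedding
  -- the shells
  set S : ℕ → Set (EuclideanSpace ℝ (Fin 3)) := fun k =>
    {y | c ^ k * a ≤ ‖y‖ ∧ ‖y‖ < c ^ (k + 1) * a} with hS
  have hSm : ∀ k, MeasurableSet (S k) := fun k =>
    (isClosed_le continuous_const continuous_norm).measurableSet.inter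
      (isOpen_lt continuous_norm continuous_const).measurableSet
  have hcover : (ball (0 : EuclideanSpace ℝ (Fin 3)) a)ᶜ ⊆ ⋃ k, S k := by
    intro y hy
    rw [mem_compl_iff, mem_ball_zero_iff, not_lt] at hy
    have hx : 1 ≤ ‖y‖ / a := by rwa [le_div_iff₀ ha, one_mul]
    obtain ⟨n, hn1, hn2⟩ := exists_nat_pow_near hx hc
    refine mem_iUnion.2 ⟨n, ?_, ?_⟩
    · rwa [le_div_iff₀ ha] at hn1
    · rwa [div_lt_iff₀ ha] at hn2
  -- the integrand
  set F : EuclideanSpace ℝ (Fin 3) → ℝ≥0∞ := fun y =>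
    ‖u t (x₀ + y)‖ₑ ^ 2 * ENNReal.ofReal ((‖y‖ ^ 3)⁻¹) with hF
  -- the bound on one shell
  have hshell : ∀ k : ℕ, ∫⁻ y in S k, F y ≤ (ENNReal.ofReal (c / a ^ 3) * M₀) * r ^ k := by
    intro k
    have hck : 0 < c ^ k * a := by positivity
    set γ : ℝ := c ^ (k + 1) with hγ
    have hγ0 : 0 < γ := by positivity
    have hγ1 : 1 ≤ γ := one_le_pow₀ hc.le
    -- the weight on the shell
    have h1 : ∫⁻ y in S k, F y ≤ ∫⁻ y in S k, ‖u t (x₀ + y)‖ₑ ^ 2 * ENNReal.ofReal (((c ^ k * a) ^ 3)⁻¹) := by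
      refine setLIntegral_mono' (hSm k) fun y hy => ?_
      refine mul_le_mul' le_rfl (ENNReal.ofReal_le_ofReal ?_)
      have hy0 : 0 < ‖y‖ := lt_of_lt_of_le hck hy.1
      exact inv_anti₀ (by positivity) (pow_le_pow_left₀ hck.le hy.1 3)
    -- the shell inside the big ball around `0`
    have hSsub : S k ⊆ (fun y : EuclideanSpace ℝ (Fin 3) => x₀ + y) ⁻¹'
        ball (0 : EuclideanSpace ℝ (Fin 3)) (γ * R₀) := by
      intro y hy
      rw [mem_preimage, mem_ball_zero_iff]
      calc ‖x₀ + y‖ ≤ ‖x₀‖ + ‖y‖ := norm_add_le _ _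
        _ < ‖x₀‖ + γ * a := by rw [hγ]; linarith [hy.2]
        _ ≤ γ * ‖x₀‖ + γ * a := by nlinarith [norm_nonneg x₀]
        _ = γ * (‖x₀‖ + a) := by ring
        _ ≤ γ * R₀ := mul_le_mul_of_nonneg_left hR₀ hγ0.le
    have h2 : ∫⁻ y in S k, ‖u t (x₀ + y)‖ₑ ^ 2 ≤ ∫⁻ x in ball (0 : EuclideanSpace ℝ (Fin 3)) (γ * R₀), ‖u t x‖ₑ ^ 2 := by
      refine (lintegral_mono_set hSsub).trans (le_of_eq ?_)
      exact hmp.setLIntegral_comp_preimage_emb hme (fun x => ‖u t x‖ₑ ^ 2) _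
    -- self-similarity on the big ball
    have hdssγ : IsDiscretelySelfSimilar γ u := by
      have := hdss.zpow hc0.ne' ((k + 1 : ℕ) : ℤ)
      rwa [zpow_natCast] at this
    have htγ : t / γ ^ 2 ∈ Ioo (-ρ ^ 2) 0 := by
      have hγ2 : 1 ≤ γ ^ 2 := one_le_pow₀ hγ1
      constructor
      · have : -ρ ^ 2 * γ ^ 2 ≤ -ρ ^ 2 * 1 := by nlinarith [sq_nonneg ρ]
        rw [lt_div_iff₀ (by positivity)]
        linarith [ht.1]
      · exact div_neg_of_neg_of_pos ht0 (by positivity)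
    have h3 : ∫⁻ x in ball (0 : EuclideanSpace ℝ (Fin 3)) (γ * R₀), ‖u t x‖ₑ ^ 2 ≤ ENNReal.ofReal γ * M₀ := by
      rw [setLIntegral_ball_normSq_eq_of_dss hγ0 hdssγ t R₀]
      exact mul_le_mul' le_rfl (hM₀ _ htγ)
    -- collect
    calc ∫⁻ y in S k, F y
        ≤ ∫⁻ y in S k, ‖u t (x₀ + y)‖ₑ ^ 2 * ENNReal.ofReal (((c ^ k * a) ^ 3)⁻¹) := h1
      _ = (∫⁻ y in S k, ‖u t (x₀ + y)‖ₑ ^ 2) * ENNReal.ofReal (((c ^ k * a) ^ 3)⁻¹) :=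
          lintegral_mul_const' _ _ ENNReal.ofReal_ne_top
      _ ≤ (ENNReal.ofReal γ * M₀) * ENNReal.ofReal (((c ^ k * a) ^ 3)⁻¹) :=
          mul_le_mul' (h2.trans h3) le_rfl
      _ = (ENNReal.ofReal (c / a ^ 3) * M₀) * r ^ k := by
          rw [hr, ← ENNReal.ofReal_pow (by positivity), hγ]
          have hc0' : c ≠ 0 := hc0.ne'
          have ha0' : a ≠ 0 := ha.ne'
          have e : γ * ((c ^ k * a) ^ 3)⁻¹ = c / a ^ 3 * ((c ^ 2)⁻¹) ^ k := by
            rw [hγ, inv_pow, ← pow_mul, eq_comm, div_mul_eq_mul_div, ← div_eq_mul_inv,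
              ← div_eq_mul_inv, div_div, div_eq_div_iff (by positivity) (by positivity)]
            ring
          calc ENNReal.ofReal (c ^ (k + 1)) * (M₀ : ℝ≥0∞) * ENNReal.ofReal ((c ^ k * a) ^ 3)⁻¹
              = ENNReal.ofReal (c ^ (k + 1) * ((c ^ k * a) ^ 3)⁻¹) * M₀ := by
                rw [ENNReal.ofReal_mul (by positivity)]; ring
            _ = ENNReal.ofReal (c / a ^ 3 * ((c ^ 2)⁻¹) ^ k) * M₀ := by rw [← hγ, e]
            _ = ENNReal.ofReal (c / a ^ 3) * M₀ * ENNReal.ofReal (((c ^ 2)⁻¹) ^ k) := by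
                rw [ENNReal.ofReal_mul (by positivity)]; ring
  -- sum over the shells
  have hsum : ∫⁻ y in (ball (0 : EuclideanSpace ℝ (Fin 3)) a)ᶜ, F y ≤ Wₑ := by
    calc ∫⁻ y in (ball (0 : EuclideanSpace ℝ (Fin 3)) a)ᶜ, F y ≤ ∫⁻ y in ⋃ k, S k, F y :=
          lintegral_mono_set hcover
      _ ≤ ∑' k, ∫⁻ y in S k, F y := lintegral_iUnion_le _ _
      _ ≤ ∑' k : ℕ, (ENNReal.ofReal (c / a ^ 3) * M₀) * r ^ k := ENNReal.tsum_le_tsum hshell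
      _ = Wₑ := by rw [ENNReal.tsum_mul_left, ENNReal.tsum_geometric, hWₑ]
  -- back to the Bochner integral
  have hint : IntegrableOn (fun y => ‖u t (x₀ + y)‖ ^ 2 / ‖y‖ ^ 3)
      (ball (0 : EuclideanSpace ℝ (Fin 3)) a)ᶜ volume := by
    have hut : MemLp (fun y => u t (x₀ + y)) (ENNReal.ofReal q) volume :=
      (hLq t ht0).comp_measurePreserving hmp
    exact integrableOn_norm_sq_div_norm_cube hq hut ha
  have hnn : 0 ≤ᵐ[volume.restrict (ball (0 : EuclideanSpace ℝ (Fin 3)) a)ᶜ]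
      fun y => ‖u t (x₀ + y)‖ ^ 2 / ‖y‖ ^ 3 := ae_of_all _ fun y => by positivity
  have heq : ENNReal.ofReal (∫ y in (ball (0 : EuclideanSpace ℝ (Fin 3)) a)ᶜ, ‖u t (x₀ + y)‖ ^ 2 / ‖y‖ ^ 3) =
      ∫⁻ y in (ball (0 : EuclideanSpace ℝ (Fin 3)) a)ᶜ, F y := by
    rw [ofReal_integral_eq_lintegral_ofReal hint hnn]
    refine lintegral_congr fun y => ?_
    rw [hF]
    show ENNReal.ofReal (‖u t (x₀ + y)‖ ^ 2 / ‖y‖ ^ 3) = ‖u t (x₀ + y)‖ₑ ^ 2 * ENNReal.ofReal ((‖y‖ ^ 3)⁻¹)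
    rw [div_eq_mul_inv, ENNReal.ofReal_mul (by positivity), ← ofReal_norm,
      ENNReal.ofReal_pow (norm_nonneg _)]
  have hI0 : 0 ≤ ∫ y in (ball (0 : EuclideanSpace ℝ (Fin 3)) a)ᶜ, ‖u t (x₀ + y)‖ ^ 2 / ‖y‖ ^ 3 :=
    integral_nonneg fun y => by positivity
  rw [← ENNReal.ofReal_le_iff_le_toReal hWₑt, heq]
  exact hsum

end FarField

/-! ### `L³` on a cylinder from the scale-invariant energy bound -/

/-- **`∫∫_{Q_r(0,x₀)} |u|³ < ∞` when `A(r), E(r) < ∞`** (the `L^{10/3}` interpolation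
`exists_lintegral_tenThirds_backward_le` and `a³ ≤ 1 + a^{10/3}`). [cite: ChaeWolf2017RemovingDSS, §2 Step 4, "bounded in L^{10/3}(Q(0,R))" (arXiv p. 7)] -/
theorem lintegral_cube_lt_top_of_energy_bound (hu1 : ContDiffOn ℝ 1 (uncurry u) (Iio 0 ×ˢ univ))
    (x₀ : EuclideanSpace ℝ (Fin 3)) {r : ℝ} (hr : 0 < r) {Λ : ℝ≥0}
    (hA : cknAEss r ((0 : ℝ), x₀) u ≤ Λ)
    (hE : cknE r ((0 : ℝ), x₀) (fun t x => fderiv ℝ (u t) x) ≤ Λ) :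
    ∫⁻ w in parabolicCylinder r ((0 : ℝ), x₀), ‖u w.1 w.2‖ₑ ^ (3 : ℕ) < ⊤ := by
  obtain ⟨K, hK⟩ := exists_lintegral_tenThirds_backward_le
  have hQsub : ((parabolicCylinderOpens r ((0 : ℝ), x₀) : Opens (ℝ × EuclideanSpace ℝ (Fin 3))) :
      Set (ℝ × EuclideanSpace ℝ (Fin 3))) ⊆ Iio (0 : ℝ) ×ˢ univ := by
    intro z hz
    simp only [coe_parabolicCylinderOpens, mem_parabolicCylinder] at hz
    exact ⟨(hz.1.2 : z.1 < 0), mem_univ _⟩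
  have hwg : HasWeakSpatialGradientOn (parabolicCylinderOpens r ((0 : ℝ), x₀)) u
      (fun t x => fderiv ℝ (u t) x) := hasWeakSpatialGradientOn_of_contDiffOn isOpen_Iio hQsub hu1
  have hAt : cknAEss r ((0 : ℝ), x₀) u ≠ ∞ := ne_top_of_le_ne_top ENNReal.coe_ne_top hA
  have hEt : cknE r ((0 : ℝ), x₀) (fun t x => fderiv ℝ (u t) x) ≠ ∞ :=
    ne_top_of_le_ne_top ENNReal.coe_ne_top hE
  have h103 : ∫⁻ z in parabolicCylinder r ((0 : ℝ), x₀), ‖u z.1 z.2‖ₑ ^ (10 / 3 : ℝ) < ⊤ := by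
    refine lt_of_le_of_lt (hK u _ ((0 : ℝ), x₀) r hr hwg hAt hEt) ?_
    refine ENNReal.mul_lt_top (ENNReal.mul_lt_top (ENNReal.mul_lt_top ENNReal.coe_lt_top
      ENNReal.ofReal_lt_top) (ENNReal.rpow_lt_top_of_nonneg (by norm_num) hAt)) ?_
    exact ENNReal.add_lt_top.2 ⟨hAt.lt_top, hEt.lt_top⟩
  -- `a³ ≤ 1 + a^{10/3}`
  have hpt : ∀ a : ℝ≥0∞, a ^ (3 : ℕ) ≤ 1 + a ^ (10 / 3 : ℝ) := by
    intro a
    rcases le_or_gt a 1 with h | h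
    · exact (pow_le_one₀ (zero_le) h).trans le_self_add
    · have : a ^ (3 : ℕ) ≤ a ^ (10 / 3 : ℝ) := by
        rw [← ENNReal.rpow_natCast]
        exact ENNReal.rpow_le_rpow_of_exponent_le h.le (by norm_num)
      exact this.trans le_add_self
  have hvol : volume (parabolicCylinder r ((0 : ℝ), x₀)) < ⊤ := by
    rw [parabolicCylinder, Measure.volume_eq_prod, Measure.prod_prod]
    exact ENNReal.mul_lt_top measure_Ioo_lt_top measure_ball_lt_top
  calc ∫⁻ w in parabolicCylinder r ((0 : ℝ), x₀), ‖u w.1 w.2‖ₑ ^ (3 : ℕ)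
      ≤ ∫⁻ w in parabolicCylinder r ((0 : ℝ), x₀), (1 + ‖u w.1 w.2‖ₑ ^ (10 / 3 : ℝ)) :=
        lintegral_mono fun w => hpt _
    _ = volume (parabolicCylinder r ((0 : ℝ), x₀)) +
          ∫⁻ w in parabolicCylinder r ((0 : ℝ), x₀), ‖u w.1 w.2‖ₑ ^ (10 / 3 : ℝ) := by
        rw [lintegral_add_left measurable_const, setLIntegral_const, one_mul]
    _ < ⊤ := ENNReal.add_lt_top.2 ⟨hvol, h103⟩

end ChaeWolfDecay

/-! ### Theorem 1.1 for `q ≥ 9` and the discharges -/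

open ChaeWolfDecay in
/-- **Chae–Wolf 2017, Theorem 1.1, in the range `q ≥ 9`: the instance `9 ≤ q` of the body of the
named fact `chaeWolf2017_dss_typeI_decay`** (same binders). For `q ≥ 9` and `c > 1`, every classical
solution `(u, p)` of the unforced Navier–Stokes equations with viscosity `1` on `(−∞, 0)` with
slices in `C((−∞,0); L^q(ℝ³))` which is `c`-DSS obeys the Type I bound
`‖u(t,x)‖ ≤ C/(‖x‖ + √(−t))` ((1.5)). Steps 1, 3, 5 as printed and as in the tree's `q < 9`
proof; Step 2 with a solution-uniform constant and the NS zoom ((2.17),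
`exists_scaleInvariant_energy_bound`); Step 4 by the three-exponent Hölder inequality and the
near/far pressure class in place of Wolf's criterion (see the module docstring). [cite: ChaeWolf2017RemovingDSS, Theorem 1.1 with (1.5), range p ≥ 9 (arXiv p. 3, §2 p. 5–7)] -/
theorem chaeWolf2017_dss_typeI_decay_of_ge_nine :
    ∀ q : ℝ, 9 ≤ q → ∀ c : ℝ, 1 < c →
    ∀ (u : ℝ → EuclideanSpace ℝ (Fin 3) → EuclideanSpace ℝ (Fin 3))
      (p : ℝ → EuclideanSpace ℝ (Fin 3) → ℝ), IsClassicalNSSolutionOn (Iio 0) 1 0 u p →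
      (∀ t < 0, MemLp (u t) (ENNReal.ofReal q) volume) →
      (∀ t₀ < 0, Filter.Tendsto (fun t => eLpNorm (u t - u t₀) (ENNReal.ofReal q) volume)
        (nhdsWithin t₀ (Iio 0)) (nhds 0)) →
      IsDiscretelySelfSimilar c u → ∃ C : ℝ, HasTypeIDecay C u := by
  intro q hq9 c hc u p hsol hLq hcont hdss
  have hc0 : 0 < c := one_pos.trans hc
  have hq0 : 0 < q := by linarith
  have hq2 : (2 : ℝ) < q := by linarith
  have hq3 : (3 : ℝ) ≤ q := by linarith
  have hq4 : (4 : ℝ) ≤ q := by linarith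
  have hq1 : (1 : ℝ≥0∞) ≤ ENNReal.ofReal q := by
    rw [← ENNReal.ofReal_one]; exact ENNReal.ofReal_le_ofReal (by linarith)
  have hucont : ContinuousOn (uncurry u) (Iio 0 ×ˢ univ) := hsol.smooth_velocity.continuousOn
  have hu1 : ContDiffOn ℝ 1 (uncurry u) (Iio 0 ×ˢ univ) := hsol.smooth_velocity.of_le (by norm_cast)
  -- ## Step 1: the rate `‖u(t)‖_q ≤ K₀ (−t)^{−κ}`, `κ = (q−3)/(2q)`, for all `t < 0`
  obtain ⟨N, hN⟩ := exists_eLpNorm_le_on_strip hq1 hLq hcont (a := -c ^ 2) (b := -1) (by norm_num)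
  set κ : ℝ := (q - 3) / (2 * q) with hκ
  have hκ0 : 0 ≤ κ := by rw [hκ]; positivity
  have hκ2 : 2 * κ < 1 := by
    have h1 : 2 * κ = (q - 3) / q := by
      rw [hκ, mul_div_assoc', div_eq_div_iff (by positivity) hq0.ne']
      ring
    rw [h1, div_lt_one hq0]
    linarith
  set K₀ : ℝ := c ^ (1 - 3 / q) * N with hK₀
  have hK₀0 : 0 ≤ K₀ := by positivity
  have hrate : ∀ t < (0 : ℝ),
      eLpNorm (u t) (ENNReal.ofReal q) volume ≤ ENNReal.ofReal (K₀ * (-t) ^ (-κ)) := by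
    intro t ht
    have key := eLpNorm_le_of_dss_of_strip_bound hc hdss (p := ENNReal.ofReal q)
      (by rw [← ENNReal.ofReal_ofNat 3]; exact ENNReal.ofReal_le_ofReal hq3) ENNReal.ofReal_ne_top
      (N := N) hN ht
    rw [ENNReal.toReal_ofReal hq0.le] at key
    refine key.trans (le_of_eq ?_)
    have hnt : 0 < -t := by linarith
    have hA : 0 ≤ c ^ (1 - 3 / q) * (-t) ^ ((3 / q - 1) / 2) :=
      mul_nonneg (Real.rpow_nonneg hc0.le _) (Real.rpow_nonneg hnt.le _)
    have e : (3 / q - 1) / 2 = -κ := by rw [hκ]; field_simp; ring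
    rw [← ENNReal.ofReal_coe_nnreal, ← ENNReal.ofReal_mul hA, hK₀, e]
    congr 1; ring
  have hrate' : ∀ t < (0 : ℝ), eLpNorm (u t) (ENNReal.ofReal q) volume ≤
      ENNReal.ofReal (K₀ * (-t) ^ (-((q - 3) / (2 * q)))) := hrate
  -- ## Step 3: the weighted Serrin integral on the annulus of `c²`
  have hc2 : 1 < c ^ 2 := by nlinarith
  have hdss2 : IsDiscretelySelfSimilar (c ^ 2) u := by
    have := hdss.zpow hc0.ne' 2
    rwa [zpow_ofNat] at this
  set D : Set (EuclideanSpace ℝ (Fin 3)) := {x | 1 ≤ ‖x‖ ∧ ‖x‖ < c ^ 2} with hD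
  obtain ⟨N₂, hN₂⟩ := exists_eLpNorm_le_on_strip hq1 hLq hcont (a := -(c ^ 2) ^ 2) (b := -1) (by norm_num)
  have hfin : ∫⁻ z in Iio (0 : ℝ) ×ˢ D, ‖u z.1 z.2‖ₑ ^ q * ENNReal.ofReal ((-z.1) ^ ((q - 5) / 2)) < ⊤ := by
    refine lt_of_le_of_lt (lintegral_weighted_annulus_le hc2 hdss2 hq0) ?_
    refine ENNReal.mul_lt_top ENNReal.ofReal_lt_top ?_
    exact lintegral_strip_lt_top hucont hq0 (by norm_num) hN₂
  -- ## the annulus of top points: `a = √c`, `[a, ca] ⊆ (1, c²)`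
  set a : ℝ := Real.sqrt c with ha
  have ha1 : 1 < a := by rw [ha]; exact Real.lt_sqrt_of_sq_lt (by simpa using hc)
  have hac : c * a < c ^ 2 := by
    have : a < c := by
      rw [ha, Real.sqrt_lt' hc0]; nlinarith
    nlinarith
  set ρ : ℝ := min (a - 1) (c ^ 2 - c * a) / 8 with hρ
  have hmin0 : 0 < min (a - 1) (c ^ 2 - c * a) := lt_min (by linarith) (by linarith)
  have hρ0 : 0 < ρ := by rw [hρ]; positivity
  have h4ρa : 4 * ρ < a - 1 := by
    rw [hρ]; linarith [min_le_left (a - 1) (c ^ 2 - c * a)]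
  have h4ρc : 4 * ρ < c ^ 2 - c * a := by
    rw [hρ]; linarith [min_le_right (a - 1) (c ^ 2 - c * a)]
  have hballD : ∀ x₀ : EuclideanSpace ℝ (Fin 3), a ≤ ‖x₀‖ → ‖x₀‖ ≤ c * a → ball x₀ ρ ⊆ D := by
    intro x₀ h1 h2 y hy
    rw [mem_ball, dist_eq_norm] at hy
    have hlow : ‖x₀‖ - ‖y - x₀‖ ≤ ‖y‖ := by
      have := norm_sub_norm_le x₀ (x₀ - y)
      rw [sub_sub_cancel, norm_sub_rev] at this
      linarith [abs_norm_sub_norm_le x₀ y, norm_sub_rev x₀ y]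
    have hup : ‖y‖ ≤ ‖x₀‖ + ‖y - x₀‖ := by
      have := norm_add_le x₀ (y - x₀); rwa [add_sub_cancel] at this
    exact ⟨by linarith, by linarith⟩
  -- ## (2.17): the scale-invariant energy bound at every top point and every scale
  obtain ⟨Λ, hΛ⟩ := exists_scaleInvariant_energy_bound hq4 hK₀0
  have hΛu := hΛ u p hsol hLq hrate'
  -- ## Steps 2 and 4 at each top point, Step 5
  refine hsol.exists_hasTypeIDecay_of_local_bounds hc hdss (a := a) (by linarith) fun x₀ hx1 hx2 => ?_
  -- a time horizon covering all cylinders in play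
  set R₀ : ℝ := ‖x₀‖ + 4 * ρ with hR₀
  have hR₀0 : 0 < R₀ := by rw [hR₀]; positivity
  set T : ℝ := R₀ ^ 2 + 1 with hT
  have hρR₀ : ρ ≤ R₀ := by rw [hR₀]; linarith [norm_nonneg x₀]
  have hρT : ρ ^ 2 < T := by
    rw [hT]; nlinarith
  have hR₀T : R₀ ^ 2 < T := by rw [hT]; linarith
  have hLqT : ∀ t ∈ Ioo (-T) 0, MemLp (u t) (ENNReal.ofReal q) volume := fun t ht => hLq t ht.2
  have hrateT : ∀ t ∈ Ioo (-T) 0,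
      eLpNorm (u t) (ENNReal.ofReal q) volume ≤ ENNReal.ofReal (K₀ * (-t) ^ (-κ)) :=
    fun t ht => hrate t ht.2
  -- Step 2: energy classes on `Q_ρ(0, x₀)`
  obtain ⟨⟨CE, hCE⟩, hG⟩ :=
    hsol.exists_energy_classes_of_rate_absorb hq4 hκ0 hκ2 hK₀0 hLqT hrateT x₀ hρ0 hρT
  -- near field: `∫∫_{Q_{4ρ}(0,x₀)} |u|³ < ∞`
  have h4ρ0 : 0 < 4 * ρ := by positivity
  have hL3 : ∫⁻ w in parabolicCylinder (4 * ρ) ((0 : ℝ), x₀), ‖u w.1 w.2‖ₑ ^ (3 : ℕ) < ⊤ :=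
    lintegral_cube_lt_top_of_energy_bound hu1 x₀ h4ρ0 (hΛu x₀ (4 * ρ) h4ρ0).1 (hΛu x₀ (4 * ρ) h4ρ0).2
  -- far field: the energy on `B(0, R₀)` and the DSS shell sum
  obtain ⟨⟨M₀, hM₀⟩, -⟩ :=
    hsol.exists_energy_classes_of_rate_absorb hq4 hκ0 hκ2 hK₀0 hLqT hrateT 0 hR₀0 hR₀T
  have hM₀' : ∀ t ∈ Ioo (-ρ ^ 2) 0,
      ∫⁻ x in ball (0 : EuclideanSpace ℝ (Fin 3)) R₀, ‖u t x‖ₑ ^ 2 ≤ M₀ := by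
    intro t ht
    refine hM₀ t ⟨?_, ht.2⟩
    have : ρ ^ 2 ≤ R₀ ^ 2 := pow_le_pow_left₀ hρ0.le hρR₀ 2
    linarith [ht.1]
  obtain ⟨W₀, hW⟩ := exists_farField_bound_of_dss hc hdss hq2 hLq hM₀' x₀ h4ρ0 (by rw [hR₀])
  -- the pressure class on `Q_ρ(0, x₀)`
  obtain ⟨m, -, hreg, hpm⟩ :=
    hsol.exists_pressure_class_of_farField hq3 hκ0 hK₀0 hLqT hrateT x₀ hρ0 hρT hL3 hW
  -- Step 4: `C(r) → 0`
  have hlim := tendsto_cknC_zero_of_weighted_lt_top_of_energy hu1 hq9 hfin x₀ hρ0 (hballD x₀ hx1 hx2)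
    (fun r hr => (hΛu x₀ r hr.1).1) (fun r hr => (hΛu x₀ r hr.1).2)
  -- [gus]: regularity at the top point
  exact exists_bound_near_top_of_classical_Iio hsol x₀ hρ0 hreg hCE hG hpm hlim

/-- **Discharge of `chaeWolf2017_dss_typeI_decay_ge_nine`** (Chae–Wolf 2017, Thm. 1.1, range
`p ≥ 9`). [cite: ChaeWolf2017RemovingDSS, Theorem 1.1 with (1.5), case p ≥ 9 (§2, after (2.4f))] -/
theorem chaeWolf2017_dss_typeI_decay_ge_nine_holds : chaeWolf2017_dss_typeI_decay_ge_nine :=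
  chaeWolf2017_dss_typeI_decay_of_ge_nine

/-- **Discharge of `chaeWolf2017_dss_typeI_decay`: Chae–Wolf 2017, Theorem 1.1, for every
`3 ≤ p < ∞`** — `3 ≤ p < 9` by the tree's `chaeWolf2017_dss_typeI_decay_of_lt_nine`, `p ≥ 9` by
`chaeWolf2017_dss_typeI_decay_ge_nine_holds`, assembled by `chaeWolf2017_dss_typeI_decay_holds_of`.
[cite: ChaeWolf2017RemovingDSS, Theorem 1.1 with (1.5) (arXiv p. 3)] -/
theorem chaeWolf2017_dss_typeI_decay_holds : chaeWolf2017_dss_typeI_decay :=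
  chaeWolf2017_dss_typeI_decay_holds_of chaeWolf2017_dss_typeI_decay_ge_nine_holds

end Literature.Analysis.FluidPDE

end
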